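import Literature.AlgebraicGeometry.Resolution.EmbeddedResolutionExcellentSurfacesSequence
import Literature.AlgebraicGeometry.Resolution.Principalization
import Literature.AlgebraicGeometry.Resolution.TransversalUnionSNC
import Literature.AlgebraicGeometry.Resolution.StrictNormalCrossingsHasSNC
import Literature.AlgebraicGeometry.Resolution.SncSaturatedCentre
import Literature.AlgebraicGeometry.Resolution.MonomialMarkedIdeals
import Literature.AlgebraicGeometry.Resolution.BoundarySplitting
import Literature.AlgebraicGeometry.Resolution.RetractionBlowupTransform
import Literature.AlgebraicGeometry.Resolution.BlowupsProduct
import Literature.AlgebraicGeometry.Resolution.BlowupsIntegral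
import Literature.AlgebraicGeometry.Resolution.NormalCrossingsStrictification
import Literature.AlgebraicGeometry.Resolution.ArithmeticalThreefoldsBlowupFormDimThree
import Literature.AlgebraicGeometry.Resolution.BlowupChartMembership
import Literature.AlgebraicGeometry.Resolution.NonPrincipalLocus
import Literature.Topology.KrullDimensionDrop
import HarnessLib

/-!
# Crux `PatchingRelPerfect` (stmt-ResolutionOfSingularities-16161), chain W5.2 — programme r-d1,
# target A2s `RegularizeSupport`: regularization of the support of a locally principal ideal
# sheaf on a regular excellent threefold (CJS plumbing)

[OURS · L1 W5.2 · r-d1 A2s] The target `DepthOneTargets.RegularizeSupport` of the crux planner's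
typed work breakdown (`ChainW52TargetsE.lean`, CRUX-PLAN v3.2 §6g), proved BY CONTENT and
GENERICALLY IN THE SEQUENCE PREDICATE: for every predicate `P ρ 𝔟 𝔟'` on (morphism, ideal
sheaf downstairs, ideal sheaf upstairs) that holds for the identity (`hnil`) and is stable under
post-composition with one blowing up `τ` along a centre `C` with regular `V(C)`, `𝔟' ≤ C` and
the controlled-transform format `𝔟'𝒪 = C𝒪 · 𝔟''` (`hcons`) — the two constructors of the
planner's `IsControlledSeq` —, and given the named fact
`CossartJannsenSaito2020EmbeddedSequenceB` (CJS 2020 Thm. 1.4 as a sequence of complete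
`𝓑`-permissible blowing ups, corrected per-step clause; F-32bR), every non-zero locally principal
ideal sheaf `𝔟` on a regular, excellent, integral Noetherian scheme `E` of dimension three is
carried by a `P`-sequence to a non-zero locally principal `𝔟'` on a regular integral Noetherian
`E'` whose support lies in a finite union of closed sets `D` with `𝓘(D)` an effective Cartier
divisor and `V(𝓘(D))` regular. Instantiating `P := IsControlledSeq` gives `RegularizeSupport`
verbatim (three lines, once the planner's definitions file is in the tree).

Proof. `X := Supp 𝔟` is a closed subset `≠ E` (the generic point is off the support of a
non-zero ideal), hence of dimension `≤ 2`; CJS (`….of_isClosed`) gives `π : Z₁ → E`, a sequence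
of blowing ups in regular centres `D_j = V(C_j)` with `𝓘(X_j) ≤ C_j`, `X_j` the iterated strict
transform, ending with `Z₁` regular, `X₁` regular and transversal to the strict normal crossings
divisor `B₁`, `π⁻¹(X) = X₁ ∪ B₁`. TRANSPORT (induction on the sequence, `transport`): the
controlled transforms `𝔟_{j+1} := (𝔟_j𝒪 : C_j𝒪)` satisfy `𝔟_j𝒪 = C_j𝒪 · 𝔟_{j+1}`
(`IsBlowup.comap_mul_controlledTransform_one`, as `𝔟_j ≤ 𝓘(X_j) ≤ C_j` because
`X_j ⊆ Supp 𝔟_j`), stay effective Cartier (`IsEffectiveCartier.comap_of_isBlowup`,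
`.of_mul_right`), and `X_{j+1} = closure τ⁻¹(X_j ∖ D_j) ⊆ Supp 𝔟_{j+1}` since
`τ⁻¹ Supp 𝔟_j = τ⁻¹ D_j ∪ Supp 𝔟_{j+1}`; the schemes stay integral (`IsBlowup.isIntegral`) and
Noetherian. END: `X₁ ∪ B₁ = Supp(𝔟𝒪_{Z₁})` is the support of an effective Cartier divisor, so
`X₁ ∪ B₁` is a strict normal crossings divisor (`IsTransversalWith.isStrictNormalCrossingsDivisor_union`)
and is the union of the supports of a list of ideal sheaves with simple normal crossings
(`IsStrictNormalCrossingsDivisor.exists_hasSNC`), each an effective Cartier divisor with regular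
zero scheme and equal to the vanishing ideal of its support. NOT a statement of the manuscript
under review; the CJS fact enters only as a hypothesis.

## References

* V. Cossart, U. Jannsen, S. Saito, *Desingularization: Invariants and Strategy*, LNM 2270
  (2020), Thm. 1.4, Cor. 1.5, Def. 4.1, (6.2)/Def. 6.8, Thm. 6.9 (a). [CossartJannsenSaito2020]
* J. Kollár, *Lectures on Resolution of Singularities* (2007), (3.111) Step 3. [Kollar2007]
* The Stacks Project, Tags 0BI9, 0BIA, 07ZV. [StacksProject]
-/

-- `Summit.<Summit>.<Sub>.Theorems` with `Sub = Summit` (single-conjunct summit, D-0017)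
set_option linter.dupNamespace false

noncomputable section

open CategoryTheory CategoryTheory.Limits AlgebraicGeometry TopologicalSpace
open Literature.AlgebraicGeometry.Resolution Scheme.IdealSheafData

namespace Summit.ResolutionOfSingularities.ResolutionOfSingularities.Theorems

universe u

namespace DepthOneRegularize

/-! ## Transport of the controlled transform along a `𝓑`-permissible sequence -/

/-- **Transport.** Along a sequence of complete `𝓑`-permissible blowing ups over `X = Supp 𝔟`
(`IsBPermissibleSequenceB`; only «`V(C_j)` regular», «`𝓘(X_j) ≤ C_j`» and the shape of the strict
transform are used) starting from an integral Noetherian `E` and an effective Cartier `𝔟`, the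
iterated controlled transforms form a `P`-sequence of non-zero effective Cartier ideal sheaves whose
support contains the strict transform `X_j` and lies over `Supp 𝔟`; all schemes are integral and
Noetherian and `𝔟𝒪` stays effective Cartier. [cite: Kollar2007, (3.111) Step 3]
[cite: CossartJannsenSaito2020, (6.2), Def. 6.8] -/
theorem transport
    (P : ∀ ⦃E' E : Scheme.{u}⦄, (E' ⟶ E) → E.IdealSheafData → E'.IdealSheafData → Prop)
    (hnil : ∀ (E : Scheme.{u}) (𝔟 : E.IdealSheafData), P (𝟙 E) 𝔟 𝔟)
    (hcons : ∀ ⦃E'' E' E : Scheme.{u}⦄ (τ : E'' ⟶ E') (ρ : E' ⟶ E) (𝔟 : E.IdealSheafData)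
      (𝔟' : E'.IdealSheafData) (𝔟'' : E''.IdealSheafData) (C : E'.IdealSheafData),
      P ρ 𝔟 𝔟' → Scheme.IsRegular C.subscheme → 𝔟' ≤ C → IsBlowup τ C →
      𝔟'.comap τ = C.comap τ * 𝔟'' → P (τ ≫ ρ) 𝔟 𝔟'')
    {E : Scheme.{u}} [IsIntegral E] [IsNoetherian E] (𝔟 : E.IdealSheafData)
    (h𝔟 : IsEffectiveCartier 𝔟) (h𝔟ne : 𝔟 ≠ ⊥) :
    ∀ {Z' : Scheme.{u}} {σ : Z' ⟶ E} {X' B' : Set Z'},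
      IsBPermissibleSequenceB (𝔟.support : Set E) (∅ : Set E) σ X' B' →
      IsIntegral Z' ∧ IsNoetherian Z' ∧ IsEffectiveCartier (𝔟.comap σ) ∧
      ∃ 𝔟' : Z'.IdealSheafData, P σ 𝔟 𝔟' ∧ IsEffectiveCartier 𝔟' ∧ 𝔟' ≠ ⊥ ∧
        X' ⊆ (𝔟'.support : Set Z') ∧ (𝔟'.support : Set Z') ⊆ σ ⁻¹' (𝔟.support : Set E) := by
  intro Z' σ X' B' h
  induction h with
  | refl =>
    refine ⟨inferInstance, inferInstance, by rwa [Scheme.IdealSheafData.comap_id], 𝔟, hnil E 𝔟,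
      h𝔟, h𝔟ne, subset_rfl, fun x hx => by simpa using hx⟩
  | @blowup Z' Z'' σ X' B' h C τ hτ hreg hsub hBsing hperm hnc ih =>
    obtain ⟨hint, hnoeth, hcart, 𝔟₁, hP, h𝔟₁, h𝔟₁ne, hX', hsupp⟩ := ih
    haveI := hint
    haveI := hnoeth
    -- `𝔟₁ ≤ 𝓘(X') ≤ C` since `closure X' ⊆ Supp 𝔟₁`
    have hle : 𝔟₁ ≤ vanishingIdeal ⟨closure X', isClosed_closure⟩ := by
      rw [← le_support_iff_le_vanishingIdeal]
      exact closure_minimal hX' 𝔟₁.support.isClosed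
    have h𝔟₁C : 𝔟₁ ≤ C := hle.trans hsub
    have hC : C ≠ ⊥ := fun hC => h𝔟₁ne (le_bot_iff.mp (hC ▸ h𝔟₁C))
    haveI : IsIntegral Z'' := hτ.isIntegral hC
    haveI : IsNoetherian Z'' := isNoetherian_of_isBlowup hτ
    -- the controlled transform and its format
    set 𝔟₂ : Z''.IdealSheafData := controlledTransform τ C 𝔟₁ 1 with h𝔟₂def
    have hfmt : 𝔟₁.comap τ = C.comap τ * 𝔟₂ := (hτ.comap_mul_controlledTransform_one h𝔟₁C).symm
    have h𝔟₂ : IsEffectiveCartier 𝔟₂ := by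
      have h := h𝔟₁.comap_of_isBlowup hτ
      rw [hfmt] at h
      exact h.of_mul_right
    -- an effective Cartier divisor on a non-empty scheme is not the zero ideal sheaf
    have h𝔟₂ne : 𝔟₂ ≠ ⊥ := by
      intro h0
      obtain ⟨U, hxU, g, hg, hU⟩ := h𝔟₂ (Classical.arbitrary Z'')
      rw [h0, Scheme.IdealSheafData.ideal_bot, Pi.bot_apply, eq_comm,
        Ideal.span_singleton_eq_bot] at hU
      subst hU
      haveI : Nonempty (U : Z''.Opens) := ⟨⟨_, hxU⟩⟩
      exact zero_notMem_nonZeroDivisors hg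
    refine ⟨inferInstance, inferInstance, ?_, 𝔟₂, hcons τ σ 𝔟 𝔟₁ 𝔟₂ C hP hreg h𝔟₁C hτ hfmt,
      h𝔟₂, h𝔟₂ne, ?_, ?_⟩
    · rw [Scheme.IdealSheafData.comap_comp]
      exact hcart.comap_of_isBlowup hτ
    · -- `closure τ⁻¹(X' ∖ V(C)) ⊆ Supp 𝔟₂`: `τ⁻¹ Supp 𝔟₁ = τ⁻¹ V(C) ∪ Supp 𝔟₂`
      refine closure_minimal ?_ 𝔟₂.support.isClosed
      rintro y ⟨hyX, hyC⟩
      have hy : y ∈ ((𝔟₁.comap τ).support : Set Z'') := by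
        rw [support_comap, Closeds.coe_preimage]
        exact hX' hyX
      rw [hfmt, support_mul, Closeds.coe_sup, support_comap, Closeds.coe_preimage] at hy
      exact hy.resolve_left hyC
    · -- `Supp 𝔟₂ ⊆ Supp 𝔟₁𝒪 = τ⁻¹ Supp 𝔟₁ ⊆ (τ ≫ σ)⁻¹ Supp 𝔟`
      intro y hy
      have hy' : y ∈ ((𝔟₁.comap τ).support : Set Z'') :=
        support_antitone (comap_le_controlledTransform τ C 𝔟₁ 1) hy
      rw [support_comap, Closeds.coe_preimage] at hy'
      have := hsupp hy'
      simpa [Scheme.Hom.comp_apply] using this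

/-! ## The target, generic in the sequence predicate -/

/-- **A2s `RegularizeSupport`, by content and generic in the sequence predicate** (see the module
docstring): with `P`, `hnil`, `hcons` the shape of the planner's `IsControlledSeq` and its two
constructors, and `CossartJannsenSaito2020EmbeddedSequenceB` as hypothesis, every non-zero
locally principal ideal sheaf on a regular excellent integral Noetherian threefold is carried by a
`P`-sequence to a non-zero locally principal ideal sheaf on a regular integral Noetherian scheme
whose support lies in a finite union of closed sets `D` with `𝓘(D)` effective Cartier and
`V(𝓘(D))` regular (the components of `X₁ ∪ B₁ = π⁻¹(Supp 𝔟)`, a strict normal crossings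
divisor). [cite: CossartJannsenSaito2020, Thm. 1.4, Cor. 1.5] [cite: Kollar2007, (3.111) Step 3]
[cite: StacksProject, Tag 0BIA] -/
theorem regularizeSupport_of_seqPred
    (P : ∀ ⦃E' E : Scheme.{u}⦄, (E' ⟶ E) → E.IdealSheafData → E'.IdealSheafData → Prop)
    (hnil : ∀ (E : Scheme.{u}) (𝔟 : E.IdealSheafData), P (𝟙 E) 𝔟 𝔟)
    (hcons : ∀ ⦃E'' E' E : Scheme.{u}⦄ (τ : E'' ⟶ E') (ρ : E' ⟶ E) (𝔟 : E.IdealSheafData)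
      (𝔟' : E'.IdealSheafData) (𝔟'' : E''.IdealSheafData) (C : E'.IdealSheafData),
      P ρ 𝔟 𝔟' → Scheme.IsRegular C.subscheme → 𝔟' ≤ C → IsBlowup τ C →
      𝔟'.comap τ = C.comap τ * 𝔟'' → P (τ ≫ ρ) 𝔟 𝔟'')
    (hCJS : CossartJannsenSaito2020EmbeddedSequenceB.{u})
    (E : Scheme.{u}) [IsIntegral E] [IsNoetherian E] (hreg : Scheme.IsRegular E)
    (hexc : Scheme.IsExcellent E) (hdim : topologicalKrullDim E = 3) (𝔟 : E.IdealSheafData)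
    (h𝔟 : 𝔟 ≠ ⊥) (hlp : IsLocallyPrincipal 𝔟) :
    ∃ (E' : Scheme.{u}) (ρ : E' ⟶ E) (𝔟' : E'.IdealSheafData) (s : Finset (Closeds E')),
      P ρ 𝔟 𝔟' ∧ IsIntegral E' ∧ IsNoetherian E' ∧ Scheme.IsRegular E' ∧
      𝔟' ≠ ⊥ ∧ IsLocallyPrincipal 𝔟' ∧
      (∀ D ∈ s, IsEffectiveCartier (Scheme.IdealSheafData.vanishingIdeal D) ∧
        Scheme.IsRegular (Scheme.IdealSheafData.vanishingIdeal D).subscheme) ∧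
      (𝔟'.support : Set E') ⊆ ⋃ D ∈ s, (D : Set E') := by
  classical
  have h𝔟c : IsEffectiveCartier 𝔟 := hlp.isEffectiveCartier_of_ne_bot h𝔟
  -- `X = Supp 𝔟` is closed, `≠ E`, of dimension `≤ 2`
  set X : Set E := (𝔟.support : Set E) with hXdef
  have hXc : IsClosed X := 𝔟.support.isClosed
  have hXne : X ≠ Set.univ := fun hX =>
    not_mem_support_genericPoint h𝔟 (show genericPoint E ∈ X from hX ▸ Set.mem_univ _)
  have hdimX : topologicalKrullDim X ≤ 2 := by
    have hlt := Literature.Topology.topologicalKrullDim_lt_of_isClosed_ssubset hXc hXne (2 + 1)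
      (by rw [hdim]; exact_mod_cast (by norm_num : (3 : ℕ) < 2 + 1 + 1))
    rw [Nat.cast_add_one] at hlt
    exact_mod_cast (ENat.WithBot.lt_add_one_iff.mp hlt)
  -- CJS: the `𝓑`-permissible sequence over `X`
  obtain ⟨Z₁, π, X₁, B₁, hT, hZ₁, -, -, -, -, hB₁, htot, htr⟩ :=
    hCJS.of_isClosed E hreg hexc X hXc hdimX
  -- transport of the controlled transform
  obtain ⟨hint, hnoeth, hcart, 𝔟', hP, h𝔟', h𝔟'ne, -, hsub⟩ :=
    transport P hnil hcons 𝔟 h𝔟c h𝔟 hT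
  haveI := hint
  haveI := hnoeth
  have hX₁c : IsClosed X₁ := (hT.isEmbeddedTransform hXc).isClosed_transform hXc
  -- `X₁ ∪ B₁ = Supp (𝔟𝒪_{Z₁})` is a strict normal crossings divisor
  have hcl : (⟨closure (X₁ ∪ B₁), isClosed_closure⟩ : Closeds Z₁) = (𝔟.comap π).support := by
    apply Closeds.ext
    change closure (X₁ ∪ B₁) = ((𝔟.comap π).support : Set Z₁)
    rw [(hX₁c.union hB₁.isClosed).closure_eq, support_comap, Closeds.coe_preimage, ← htot]
  have hsnc : IsStrictNormalCrossingsDivisor Z₁ (X₁ ∪ B₁) := by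
    refine htr.isStrictNormalCrossingsDivisor_union hB₁ hX₁c fun x _ => ?_
    obtain ⟨t, ht, hst⟩ := hcart.exists_stalkIdeal_eq_span x
    refine ⟨t, nonZeroDivisors.ne_zero ht, ?_⟩
    rw [hcl, vanishingIdeal_support, stalkIdeal_radical, hst]
  -- its components: a list with simple normal crossings
  obtain ⟨Es, hEs, -, -, hU⟩ := hsnc.exists_hasSNC hZ₁
  refine ⟨Z₁, π, 𝔟', (Es.map fun D => D.support).toFinset, hP, hint, hnoeth, hZ₁, h𝔟'ne,
    h𝔟'.isLocallyPrincipal, ?_, ?_⟩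
  · intro D' hD'
    rw [List.mem_toFinset, List.mem_map] at hD'
    obtain ⟨D, hD, rfl⟩ := hD'
    rw [hEs.vanishingIdeal_support hD]
    refine ⟨hEs.isEffectiveCartier_of_mem hD, ?_⟩
    have h := hEs.isRegular_subscheme_finsetSup {D} (fun K hK => by
      rw [Finset.mem_singleton] at hK
      exact hK ▸ hD)
    rwa [Finset.sup_singleton, id] at h
  · intro y hy
    have hy' : y ∈ X₁ ∪ B₁ := by
      rw [← htot]
      exact hsub hy
    rw [← hU] at hy'
    simp only [Set.mem_iUnion, exists_prop] at hy' ⊢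
    obtain ⟨D, hD, hyD⟩ := hy'
    exact ⟨D.support, by rw [List.mem_toFinset, List.mem_map]; exact ⟨D, hD, rfl⟩, hyD⟩

end DepthOneRegularize

end Summit.ResolutionOfSingularities.ResolutionOfSingularities.Theorems

end
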